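import Literature.NumberTheory.EllipticCurves.CompactSelmerKummerDescent
import HarnessLib

/-!
# Compact Kummer descent, finitely-generated form: `S_p`-type families with bounded `Ш`-image lie in
# `E(L) ⊗ ℤ_p` for ANY finite generating set of `E(L)` (no independence, no `E(L)[p] = 0`)

Topic `NumberTheory/EllipticCurves`; sequel of `CompactSelmerKummerDescent` (same seat, `bsd-cm-k8i-c2` g8),
answering the cell's review of that file (seat `bsd-cm-k7r-c2` g5, STATUS 2026-08-26T22:54Z): the
`ℤ_p`-coordinate argument of Part 3 there needs neither independence of the generators modulo torsion nor
`E(L)[p] = 0` — choosing the integer coordinates of the levelwise points INDUCTIVELY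
(`a^{(k+1)} := a^{(k)} + p^k b^{(k)}`, where `P_{k+1} − P_k = p^k R_k` and `R_k = ∑ b^{(k)}_i g_i`) makes them
`p`-adically compatible by construction. Generic: any field `K`, any subgroup `H ≤ Γ_K` (`L = K̄^H`), any
prime `p`; everything PROVED; no `Summits` import; nothing about a particular curve is asserted.

* `mem_kummerSpan_range_of_forall_eq_kummerFamily_apply_of_forall_exists_sum` — generators `g : Fin r → E(L)`
  of `E(L)` as an abelian group (`∀ R, ∃ a, ∑ a_i • g_i = R`), `x` compatible and levelwise Kummer ⟹
  `x ∈ kummerSpan {g_i}`;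
* `mem_mordellWeilKummerSpan_of_forall_eq_kummerFamily_apply_of_moduleFinite` — the same from
  `Module.Finite ℤ E(L)` (Mordell–Weil in Mathlib's currency), landing in `mordellWeilKummerSpan = E(L) ⊗ ℤ_p`;
* `mem_mordellWeilKummerSpan_of_pow_smul_torsionToGeomH1Over_eq_zero_of_moduleFinite` — assembled with
  Part 2 of the predecessor file: compatible + images in `H¹(H, E(K̄))` killed by one `p^e`
  (⟸ `Ш(E/L)[p^∞]` of bounded exponent, for Selmer families) + `Module.Finite ℤ E(L)` ⟹ `x ∈ E(L) ⊗ ℤ_p`.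
  This is the `E(L) ⊗ ℤ_p`-half of `0 → E(L) ⊗ ℤ_p → S_p(E/L) → T_pШ(E/L) → 0` (Howard 2004, §1;
  Perrin-Riou 1987, §0) — the (S_sat-MW) input of the cell `bsd-cm` K7r line `rubin-formula-zp` in the form
  its frame supplies (Mordell–Weil over `K`, no `E(K)[7] = 0` binder).

References: B. Howard, Compositio 140 (2004), §1; B. Perrin-Riou, Bull. SMF 115 (1987), §0 pp. 401–402;
J.-P. Serre, *A Course in Arithmetic*, Ch. II §1 (`ℤ_p = lim← ℤ/p^n`).
-/

noncomputable section

open scoped Classical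

open Literature.NumberTheory.EllipticCurves Literature.NumberTheory.GaloisRepresentations

universe u

namespace WeierstrassCurve

variable {K : Type u} [Field K] (W : WeierstrassCurve K)

section SpanFG

variable {p : ℕ} [Fact p.Prime] {H : Subgroup (Field.absoluteGaloisGroup K)}

/-- **Compatible levelwise-Kummer families are `ℤ_p`-combinations of the Kummer families of ANY finite
generating set of `E(L)`** (`E(L) ⊗ ℤ_p = lim← E(L)/p^k E(L)` in compact currency). Let `g_1, …, g_r`
generate `E(L) = E(K̄)^H` as an abelian group (`∀ R, ∃ a ∈ ℤ^r, ∑ a_i • g_i = R`; torsion generators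
allowed, no independence). If `x ∈ ∏_k H¹(H, E[p^k])` is compatible and `x_k = δ_k(P_k)` with `P_k ∈ E(L)`
for every `k`, then `x = ∑_i c_i · δ(g_i)` for `p`-adic integers `c_i`, so `x ∈ kummerSpan {g_i}`.
Proof: compatibility and Kummer injectivity (`kummerFamily_apply_eq_zero_iff`) give `P_{k+1} − P_k = p^k R_k`,
`R_k ∈ E(L)`; with `R_k = ∑ b^{(k)}_i g_i` the coordinates `a^{(0)}` of `P_0` and
`a^{(k+1)} := a^{(k)} + p^k b^{(k)}` represent `P_k` for every `k` and are `p`-adically compatible by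
construction; `c_i` interpolates them (`exists_padicInt_toZModPow_eq_intCast`); then `x − ∑ c_i · δ(g_i)` has
`k`-th component `δ_k(p^k • ∑ m_i g_i) = 0`. Howard 2004, §1 / Perrin-Riou 1987, §0 (`E(L) ⊗ ℤ_p ↪ S_p(E/L)`).
[cite: Howard2004HeegnerKolyvagin, §1 (descent sequence for S_p(E/L))] -/
theorem mem_kummerSpan_range_of_forall_eq_kummerFamily_apply_of_forall_exists_sum [W.IsElliptic] {r : ℕ}
    (g : Fin r → W.fixedGeomPoints H)
    (hgen : ∀ R : W.fixedGeomPoints H, ∃ a : Fin r → ℤ, (∑ i, a i • g i) = R)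
    {x : W.torsionH1Pi p H} (hx : x ∈ W.compatiblePi H p)
    (hK : ∀ k, ∃ P : W.fixedGeomPoints H, x k = W.kummerFamily p H P k) :
    x ∈ W.kummerSpan p H (Set.range fun i ↦ (g i : geomPoints W))
      (fun P hP ↦ by obtain ⟨i, rfl⟩ := hP; exact (W.mem_fixedGeomPoints_iff _).1 (g i).2) := by
  classical
  choose P hP using hK
  -- `P_{k+1} - P_k = p^k • R_k` in `E(L)` (compatibility + Kummer injectivity).
  have hRex : ∀ k, ∃ R : W.fixedGeomPoints H, ((p : ℤ) ^ k) • R = P (k + 1) - P k := by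
    intro k
    have hred : W.reduceTorsionH1 p k H (x (k + 1)) = x k := (W.mem_compatiblePi_iff.1 hx) k
    have he : W.kummerFamily p H (P (k + 1)) k = W.kummerFamily p H (P k) k := by
      have h1 := (W.isKummerFamilyOver_kummerFamily p H (P (k + 1))).reduceTorsionH1 p k
      rw [← hP (k + 1), hred, hP k] at h1
      exact h1.symm
    have h2 : W.kummerFamilyHom p H (P (k + 1) - P k) =
        W.kummerFamilyHom p H (P (k + 1)) - W.kummerFamilyHom p H (P k) := map_sub _ _ _
    rw [kummerFamilyHom_apply, kummerFamilyHom_apply, kummerFamilyHom_apply] at h2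
    refine (W.kummerFamily_apply_eq_zero_iff p H _ k).1 ?_
    rw [h2, Pi.sub_apply, he, sub_self]
  choose R hR using hRex
  choose b hb using fun k ↦ hgen (R k)
  obtain ⟨a₀, ha₀⟩ := hgen (P 0)
  -- inductive integer coordinates
  let a : ℕ → Fin r → ℤ := fun k ↦ Nat.rec a₀ (fun j aj i ↦ aj i + (p : ℤ) ^ j * b j i) k
  have ha_succ : ∀ k i, a (k + 1) i = a k i + (p : ℤ) ^ k * b k i := fun _ _ ↦ rfl
  have hPa : ∀ k, (∑ i, a k i • g i) = P k := by
    intro k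
    induction k with
    | zero => exact ha₀
    | succ k ih =>
      simp only [ha_succ, add_smul, Finset.sum_add_distrib, ih, mul_smul, ← Finset.smul_sum, hb, hR]
      abel
  have hstep : ∀ k i, a (k + 1) i ≡ a k i [ZMOD (p : ℤ) ^ k] := fun k i ↦
    Int.modEq_iff_dvd.2 ⟨-b k i, by rw [ha_succ]; ring⟩
  -- `p`-adic coordinates
  choose c hc using fun i ↦ exists_padicInt_toZModPow_eq_intCast p (fun k ↦ a k i) (fun k ↦ hstep k i)
  have hS : ∀ Q ∈ Set.range (fun i ↦ (g i : geomPoints W)), ∀ σ ∈ H, σ • Q = Q := fun Q hQ ↦ by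
    obtain ⟨i, rfl⟩ := hQ; exact (W.mem_fixedGeomPoints_iff _).1 (g i).2
  have hxy : x = ∑ i, W.padicPi p H (c i) (W.kummerFamily p H (g i)) := by
    funext k
    set n : Fin r → ℤ := fun i ↦ ((PadicInt.toZModPow k (c i)).val : ℤ) with hn
    have hnmod : ∀ i, n i ≡ a k i [ZMOD (p : ℤ) ^ k] := fun i ↦
      val_toZModPow_modEq_of_toZModPow_eq p (hc i k)
    have hy : (∑ i, W.padicPi p H (c i) (W.kummerFamily p H (g i))) k =
        W.kummerFamily p H (∑ i, n i • g i) k := by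
      rw [Finset.sum_apply, ← kummerFamilyHom_apply, map_sum, Finset.sum_apply]
      refine Finset.sum_congr rfl fun i _ ↦ ?_
      rw [padicPi_apply, map_zsmul, Pi.smul_apply, kummerFamilyHom_apply]
    rw [hy, hP k, ← sub_eq_zero, ← Pi.sub_apply]
    have h2 : W.kummerFamily p H (P k) - W.kummerFamily p H (∑ i, n i • g i) =
        W.kummerFamily p H (P k - ∑ i, n i • g i) := by
      rw [← kummerFamilyHom_apply, ← kummerFamilyHom_apply, ← kummerFamilyHom_apply, map_sub]
    rw [h2, kummerFamily_apply_eq_zero_iff]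
    choose m hm using fun i ↦ Int.modEq_iff_dvd.1 (hnmod i)
    refine ⟨∑ i, m i • g i, ?_⟩
    rw [← hPa k, ← Finset.sum_sub_distrib, Finset.smul_sum]
    refine Finset.sum_congr rfl fun i _ ↦ ?_
    rw [smul_smul, ← hm i, sub_smul]
  rw [hxy]
  exact AddSubgroup.sum_mem _ fun i _ ↦
    W.padicPi_mem_kummerSpan p H hS ⟨i, rfl⟩ (c i) (W.isKummerFamilyOver_kummerFamily p H (g i))

/-- **Mordell–Weil form**: if `E(L) = E(K̄)^H` is a finitely generated abelian group (`Module.Finite ℤ`,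
Mathlib's currency of the Mordell–Weil theorem) then every compatible, levelwise-Kummer family lies in
`E(L) ⊗ ℤ_p = mordellWeilKummerSpan` (pick a finite generating family `Module.Finite.exists_fin` and apply
`mem_kummerSpan_range_of_forall_eq_kummerFamily_apply_of_forall_exists_sum`).
[cite: Howard2004HeegnerKolyvagin, §1 (descent sequence for S_p(E/L))] -/
theorem mem_mordellWeilKummerSpan_of_forall_eq_kummerFamily_apply_of_moduleFinite [W.IsElliptic]
    (hfg : Module.Finite ℤ (W.fixedGeomPoints H))
    {x : W.torsionH1Pi p H} (hx : x ∈ W.compatiblePi H p)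
    (hK : ∀ k, ∃ P : W.fixedGeomPoints H, x k = W.kummerFamily p H P k) :
    x ∈ W.mordellWeilKummerSpan p H := by
  obtain ⟨r, g, hg⟩ := Module.Finite.exists_fin (R := ℤ) (M := W.fixedGeomPoints H)
  have hgen : ∀ R : W.fixedGeomPoints H, ∃ a : Fin r → ℤ, (∑ i, a i • g i) = R := fun R ↦
    (Submodule.mem_span_range_iff_exists_fun ℤ).1 (by rw [hg]; exact Submodule.mem_top)
  exact W.kummerSpan_mono p H _ (by rintro _ ⟨i, rfl⟩; exact (g i).2)
    (W.mem_kummerSpan_range_of_forall_eq_kummerFamily_apply_of_forall_exists_sum g hgen hx hK)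

/-- **The compact Kummer descent, Mordell–Weil form.** For `L = K̄^H` with `E(L)` finitely generated, every
compatible family `x ∈ ∏_k H¹(H, E[p^k])` whose images in `H¹(H, E(K̄))` are killed by one power `p^e`
(for SELMER families: whenever the part of `Ш(E/L)[p^∞]` they reach has exponent `p^e`, e.g. `Ш(E/L)[p^∞]`
finite) lies in `E(L) ⊗ ℤ_p = mordellWeilKummerSpan` — the `E(L) ⊗ ℤ_p`-half of
`0 → E(L) ⊗ ℤ_p → S_p(E/L) → T_pШ(E/L) → 0` in compact currency, with no independence / `E(L)[p] = 0` /
global-duality input. [cite: Howard2004HeegnerKolyvagin, §1 (descent sequence for S_p(E/L))]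
[cite: PerrinRiou1987BSMF, §0 pp. 401–402 (`E(L) ⊗ ℤ_p ↪ S_p(L)`)] -/
theorem mem_mordellWeilKummerSpan_of_pow_smul_torsionToGeomH1Over_eq_zero_of_moduleFinite [W.IsElliptic]
    (hfg : Module.Finite ℤ (W.fixedGeomPoints H))
    {x : W.torsionH1Pi p H} (hx : x ∈ W.compatiblePi H p) (e : ℕ)
    (hSha : ∀ k, (p ^ e) • W.torsionToGeomH1Over ((p : ℤ) ^ k) H (x k) = 0) :
    x ∈ W.mordellWeilKummerSpan p H :=
  W.mem_mordellWeilKummerSpan_of_forall_eq_kummerFamily_apply_of_moduleFinite hfg hx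
    (W.exists_kummerFamily_apply_eq_of_pow_smul_eq_zero p H hx e hSha)

/-- **Compact-Selmer form** (`compactSelmerOver ≤ compatiblePi` is built into the definition): for
`x ∈ S_p(E/L)` with `p^e`-bounded image in `H¹(H, E(K̄))` and `E(L)` finitely generated, `x ∈ E(L) ⊗ ℤ_p`.
[cite: PerrinRiou1987BSMF, §0 pp. 401–402 (`E(L) ⊗ ℤ_p ↪ S_p(L)`)] -/
theorem mem_mordellWeilKummerSpan_of_mem_compactSelmerOver_of_moduleFinite [NumberField K] [H.Normal]
    [W.IsElliptic] (hfg : Module.Finite ℤ (W.fixedGeomPoints H))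
    {x : W.torsionH1Pi p H} (hx : x ∈ W.compactSelmerOver H p) (e : ℕ)
    (hSha : ∀ k, (p ^ e) • W.torsionToGeomH1Over ((p : ℤ) ^ k) H (x k) = 0) :
    x ∈ W.mordellWeilKummerSpan p H :=
  W.mem_mordellWeilKummerSpan_of_pow_smul_torsionToGeomH1Over_eq_zero_of_moduleFinite hfg
    (W.mem_compatiblePi_iff.2 ((W.mem_compactSelmerOver_iff H p x).1 hx).2) e hSha

end SpanFG

end WeierstrassCurve

end
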